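import Summits.QuantumFields.YangMills.Theorems.VirialFluxGapConjugationKernelAxialDots
import Summits.QuantumFields.BalabanUV.InfraRed.StrongCouplingSphereCalculus
import HarnessLib

/-!
# Route `VirialFluxGap` (YangMills): SIX ORTHONORMAL EXACT KERNEL VECTORS of the standard `X_fix` frame Hessian at a regular flat comb ring
# (part B = §7 of the six-vector package, upgrade (U3) `½(#ι − 4) → ½(#ι − 6) = 9L⁴ − 3/2`; parts ✓`…ConjugationKernelFix`, `…ConjugationKernelAxialDots`)

LEAD ym-line-sfw-p2 g97 (cell ym-idea-1, free hands; `--supports stmt-QuantumFields-24196`).  ✓`VirialFluxGapConjugationKernelFix` proved that the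
global-conjugation directions `conjDir h p` are exact kernel vectors at any zero.  Here, at a comb ring `((fun _ => combFlat h'), fun _ => c')`
with data on an axis `n ≠ 0` and at least one NON-CENTRAL datum, the two conjugation vectors for `h = quatMatrix m`, `quatMatrix m'`
(`m, m' ⊥ n`, `m ⊥ m'`) are orthogonal to the four sheet vectors of ✓`exists_four_orthonormal_kernel_vectors`, to each other, and non-zero:

* §5 quaternion letters: `conjDir (quatMatrix m) p w = quatMatrix(q̄ m q − m)` (`q = su2Quat` of the variable), the half-Pauli coordinates of a
  quaternion matrix, and the two POLYNOMIAL identities for the Pauli pairings at an AXIAL variable (`Im q = t·n`):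
  `Σ_a pc_a(q̄mq − m)pc_a(q̄m′q − m′) = 4[(S² + 4r²t²N)(m·m′) + (4t²S + 4t⁴N − 4r²t²)(m·n)(m′·n)]`, `Σ_a pc_a(q̄mq − m)pc_a(⟨0,n⟩) = 4(r² + t²N − 1)(m·n)`;
* §6 at the comb ring every variable is axial (`comb_varMat_axial`), hence: conj ⊥ wrap sheets, conj ⊥ seam sheet, conj(m) ⊥ conj(m′), and
  `|conj(m)|² ≥ 16t²N|m|² > 0` at a non-central wrap block (`th k ≠ 0`) or seam (`tc ≠ 0`) (`normSq = 1`);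
* §7 `exists_perp_pair` (two orthogonal vectors `⊥ n`), `exists_orthonormal_six` (skew/traceless slots via ✓`StrongCouplingSphereCalculus.quatMatrix_*_of_re_eq_zero`), and ★★★ `exists_six_orthonormal_kernel_vectors` — the `m = 6` input
  `hon ∕ hker` of ✓`generic_divergence_upper`: with it (E2) of ✓`fix_generic_divergence_upper` reads `½(#ι − 6) + …`, i.e. the generic Euler field has
  divergence `18L⁴ − 3 + o(1)`, matching the sharp central budget ✓`centralDiv_le_budget`; fed to ✓`gibbsMeanWindow_of_eulerFieldFixFamily` this is
  the road to ⟨24196⟩ `ToronSoftnessSharp` (✓`toronSoftnessSharp_of_eulerFieldFixFamily`).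
HONEST LABEL: linear-algebra ∕ quaternion bookkeeping; the rerun of the ⟨24141⟩ assembly with `m = 6` and `δ`-dependent parameters is NOT here; ⟨24196⟩ ∕
⟨24194⟩ ∕ ⟨24197⟩ OPEN; own crux ⟨22884⟩ OPEN (blocked-on ⟨19935⟩); the Yang–Mills mass gap is NOT proved; no summit is proved by a line.  THEOREMS ONLY
(0 `def`, 0 `sorry`), standard axioms.  References: [cite: Luscher1983, §2] (toron valley); [folklore].
-/

set_option autoImplicit false

noncomputable section

open scoped Matrix BigOperators ContDiff Topology Quaternion Matrix.Norms.Frobenius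
open MeasureTheory Set Matrix
open Literature.MathematicalPhysics.QuantumFieldTheory hiding SU2
open Literature.MathematicalPhysics.QuantumLattice
open Literature.MathematicalPhysics.QuantumFieldTheory.SUNBakryEmery (expSU coe_expSU)

namespace Summit.QuantumFields.YangMills.Theorems.VirialFluxGap.FixFrame

open Summit.QuantumFields.YangMills.Theorems.FemtoTransferGap
open Summit.QuantumFields.YangMills.Theorems.FemtoTransferGap.TT
open Summit.QuantumFields.YangMills.Theorems.FemtoTransferGap.TwoLattice
open Summit.QuantumFields.YangMills.Theorems.FemtoTransferGap.TwoLattice.Flat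
open Summit.QuantumFields.YangMills.Theorems.VirialFluxGap.RingDeficit
open Summit.QuantumFields.YangMills.Theorems.VirialFluxGap.FrameDerivative
open Summit.QuantumFields.YangMills.Theorems.VirialFluxGap.FrameHessian
open Summit.QuantumFields.YangMills.Theorems.VirialFluxGap.RegularValley

variable {L : ℕ} [NeZero L]


/-! ## §7 Six orthonormal kernel vectors at a regular comb ring -/

omit [NeZero L] in
/-- Two orthogonal non-zero vectors orthogonal to a given non-zero `n ∈ ℝ³`, as pure imaginary quaternions. [folklore] -/
theorem exists_perp_pair {n₁ n₂ n₃ : ℝ} (hn : 0 < n₁ ^ 2 + n₂ ^ 2 + n₃ ^ 2) :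
    ∃ m m' : ℍ, m.re = 0 ∧ m'.re = 0 ∧ m.imI * n₁ + m.imJ * n₂ + m.imK * n₃ = 0 ∧ m'.imI * n₁ + m'.imJ * n₂ + m'.imK * n₃ = 0 ∧
      m.imI * m'.imI + m.imJ * m'.imJ + m.imK * m'.imK = 0 ∧ 0 < m.imI ^ 2 + m.imJ ^ 2 + m.imK ^ 2 ∧
      0 < m'.imI ^ 2 + m'.imJ ^ 2 + m'.imK ^ 2 := by
  by_cases h23 : n₂ ^ 2 + n₃ ^ 2 = 0
  · have h2 : n₂ = 0 := by nlinarith [sq_nonneg n₂, sq_nonneg n₃]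
    have h3 : n₃ = 0 := by nlinarith [sq_nonneg n₂, sq_nonneg n₃]
    refine ⟨⟨0, 0, 1, 0⟩, ⟨0, 0, 0, 1⟩, rfl, rfl, ?_, ?_, ?_, ?_, ?_⟩ <;> simp [h2, h3]
  · have hpos : 0 < n₂ ^ 2 + n₃ ^ 2 := lt_of_le_of_ne (by positivity) (Ne.symm h23)
    refine ⟨⟨0, 0, n₃, -n₂⟩, ⟨0, -(n₂ ^ 2 + n₃ ^ 2), n₁ * n₂, n₁ * n₃⟩, rfl, rfl, ?_, ?_, ?_, ?_, ?_⟩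
    · dsimp only; ring
    · dsimp only; ring
    · dsimp only; ring
    · dsimp only; nlinarith
    · dsimp only
      have : 0 < (n₂ ^ 2 + n₃ ^ 2) * (n₁ ^ 2 + n₂ ^ 2 + n₃ ^ 2) := mul_pos hpos hn
      nlinarith

omit [NeZero L] in
/-- ★ Six named pairwise orthogonal non-zero kernel vectors normalise to an orthonormal kernel family indexed by `Fin 6`
(the `Fin 6` twin of ✓`exists_orthonormal_four`). [folklore] -/
theorem exists_orthonormal_six {ι : Type*} [Fintype ι] (x₀ x₁ x₂ x₃ x₄ x₅ : ι → ℝ)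
    (h01 : x₀ ⬝ᵥ x₁ = 0) (h02 : x₀ ⬝ᵥ x₂ = 0) (h03 : x₀ ⬝ᵥ x₃ = 0) (h04 : x₀ ⬝ᵥ x₄ = 0) (h05 : x₀ ⬝ᵥ x₅ = 0)
    (h12 : x₁ ⬝ᵥ x₂ = 0) (h13 : x₁ ⬝ᵥ x₃ = 0) (h14 : x₁ ⬝ᵥ x₄ = 0) (h15 : x₁ ⬝ᵥ x₅ = 0)
    (h23 : x₂ ⬝ᵥ x₃ = 0) (h24 : x₂ ⬝ᵥ x₄ = 0) (h25 : x₂ ⬝ᵥ x₅ = 0)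
    (h34 : x₃ ⬝ᵥ x₄ = 0) (h35 : x₃ ⬝ᵥ x₅ = 0) (h45 : x₄ ⬝ᵥ x₅ = 0)
    (hp0 : 0 < x₀ ⬝ᵥ x₀) (hp1 : 0 < x₁ ⬝ᵥ x₁) (hp2 : 0 < x₂ ⬝ᵥ x₂) (hp3 : 0 < x₃ ⬝ᵥ x₃) (hp4 : 0 < x₄ ⬝ᵥ x₄) (hp5 : 0 < x₅ ⬝ᵥ x₅)
    {B : Matrix ι ι ℝ} (hk0 : B *ᵥ x₀ = 0) (hk1 : B *ᵥ x₁ = 0) (hk2 : B *ᵥ x₂ = 0) (hk3 : B *ᵥ x₃ = 0) (hk4 : B *ᵥ x₄ = 0)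
    (hk5 : B *ᵥ x₅ = 0) :
    ∃ k : Fin 6 → ι → ℝ, (∀ a b, k a ⬝ᵥ k b = if a = b then 1 else 0) ∧ ∀ a, B *ᵥ k a = 0 := by
  have h10 : x₁ ⬝ᵥ x₀ = 0 := by rw [dotProduct_comm]; exact h01
  have h20 : x₂ ⬝ᵥ x₀ = 0 := by rw [dotProduct_comm]; exact h02
  have h30 : x₃ ⬝ᵥ x₀ = 0 := by rw [dotProduct_comm]; exact h03
  have h40 : x₄ ⬝ᵥ x₀ = 0 := by rw [dotProduct_comm]; exact h04
  have h50 : x₅ ⬝ᵥ x₀ = 0 := by rw [dotProduct_comm]; exact h05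
  have h21 : x₂ ⬝ᵥ x₁ = 0 := by rw [dotProduct_comm]; exact h12
  have h31 : x₃ ⬝ᵥ x₁ = 0 := by rw [dotProduct_comm]; exact h13
  have h41 : x₄ ⬝ᵥ x₁ = 0 := by rw [dotProduct_comm]; exact h14
  have h51 : x₅ ⬝ᵥ x₁ = 0 := by rw [dotProduct_comm]; exact h15
  have h32 : x₃ ⬝ᵥ x₂ = 0 := by rw [dotProduct_comm]; exact h23
  have h42 : x₄ ⬝ᵥ x₂ = 0 := by rw [dotProduct_comm]; exact h24
  have h52 : x₅ ⬝ᵥ x₂ = 0 := by rw [dotProduct_comm]; exact h25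
  have h43 : x₄ ⬝ᵥ x₃ = 0 := by rw [dotProduct_comm]; exact h34
  have h53 : x₅ ⬝ᵥ x₃ = 0 := by rw [dotProduct_comm]; exact h35
  have h54 : x₅ ⬝ᵥ x₄ = 0 := by rw [dotProduct_comm]; exact h45
  refine exists_orthonormal_of_orthogonal_kernel ![x₀, x₁, x₂, x₃, x₄, x₅] ?_ ?_ ?_
  · intro a b hab
    fin_cases a <;> fin_cases b <;> first
      | exact absurd rfl hab
      | assumption
  · intro a
    fin_cases a
    · exact hp0
    · exact hp1
    · exact hp2
    · exact hp3
    · exact hp4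
    · exact hp5
  · intro a
    fin_cases a
    · exact hk0
    · exact hk1
    · exact hk2
    · exact hk3
    · exact hk4
    · exact hk5

/-- ★★★ **SIX ORTHONORMAL EXACT KERNEL VECTORS of the standard `X_fix` frame Hessian at a REGULAR flat comb ring.**  Comb data `h'`, `c'` with
quaternions on the axis `n ≠ 0`, at least one datum NON-CENTRAL (`th k ≠ 0` for some `k`, or `tc ≠ 0`); at `p = ((fun _ => combFlat h'), fun _ => c')`,
in the frame family ✓`fixFrameStd`, there is `k : Fin 6 → ι → ℝ` with `k a ⬝ᵥ k b = δ_ab`, `Ĥ(p) k_a = 0` and `H(p) k_a = 0`: the four SHEET vectors of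
✓`exists_four_orthonormal_kernel_vectors` and the two GLOBAL-CONJUGATION vectors `fixCoord(conjDir (quatMatrix m) p)`, `m ⊥ n`.  With `m = 6` in
✓`generic_divergence_upper` the generic divergence count becomes `½(#ι − 6) = 9L⁴ − 3/2`. [cite: Luscher1983, §2] -/
theorem exists_six_orthonormal_kernel_vectors (n₁ n₂ n₃ : ℝ) (hn : 0 < n₁ ^ 2 + n₂ ^ 2 + n₃ ^ 2) {h' : Fin 3 → SU2} {c' : SU2}
    {th : Fin 3 → ℝ} {tc : ℝ}
    (hh' : ∀ j, (su2Quat (h' j)).imI = th j * n₁ ∧ (su2Quat (h' j)).imJ = th j * n₂ ∧ (su2Quat (h' j)).imK = th j * n₃)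
    (hc' : (su2Quat c').imI = tc * n₁ ∧ (su2Quat c').imJ = tc * n₂ ∧ (su2Quat c').imK = tc * n₃)
    (hreg : (∃ k, th k ≠ 0) ∨ tc ≠ 0) :
    ∃ k : Fin 6 → FixVar L × Fin 3 → ℝ, (∀ a b, k a ⬝ᵥ k b = if a = b then 1 else 0) ∧
      (∀ a, frameHessRaw (L := L) fixFrameStd (ringCoord L (((fun _ => combFlat h'), fun _ => c') :
          (Fin (2 * L - 1 + 1) → GaugeConfig 3 L SU2) × (Site 3 L → SU2))) *ᵥ k a = 0) ∧
      ∀ a, frameHess (L := L) fixFrameStd (ringCoord L (((fun _ => combFlat h'), fun _ => c') :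
          (Fin (2 * L - 1 + 1) → GaugeConfig 3 L SU2) × (Site 3 L → SU2))) *ᵥ k a = 0 := by
  set Q : Matrix (Fin 2) (Fin 2) ℂ := quatMatrix (⟨0, n₁, n₂, n₃⟩ : ℍ) with hQ
  have hQh : Qᴴ = -Q := quatMatrix_im_conjTranspose n₁ n₂ n₃
  have hQ0 : Q.trace = 0 := quatMatrix_im_trace n₁ n₂ n₃
  have hQne : Q ≠ 0 := quatMatrix_im_ne_zero hn
  set p : (Fin (2 * L - 1 + 1) → GaugeConfig 3 L SU2) × (Site 3 L → SU2) := ((fun _ => combFlat h'), fun _ => c') with hp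
  have hp0 : ringDeficit L (fun _ => false) p = 0 := by
    have h := ringDeficit_comb_seamSheet_eq_zero (L := L) n₁ n₂ n₃ hh' hc' 0
    rwa [multiCurve_zero, mul_one] at h
  have htree : ∀ e : Edge 3 L, treeEdge e = true → p.1 0 e = 1 := fun e he => by
    show combFlat h' e = 1
    rw [combFlat_apply, if_neg (fun h => not_treeEdge_of_wrap h he)]
  obtain ⟨m, m', hm, hm', hmn, hm'n, hmm', hm0, hm'0⟩ := exists_perp_pair hn
  -- kernel
  have hkerW : ∀ k : Fin 3, frameHessRaw (L := L) fixFrameStd (ringCoord L p) *ᵥ fixCoord (wrapBlockDir (L := L) k Q) = 0 := fun k =>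
    frameHessRaw_mulVec_eq_zero_of_dirOf_eq_wrapBlockDir fixFrameStd fixFrameStd_conjTranspose fixFrameStd_trace n₁ n₂ n₃ hh' hc' k
      (dirOf_fixCoord_wrapBlockDir k hQh hQ0)
  have hkerS : frameHessRaw (L := L) fixFrameStd (ringCoord L p) *ᵥ fixCoord (seamBlockDir (L := L) Q) = 0 :=
    frameHessRaw_mulVec_eq_zero_of_dirOf_eq_seamBlockDir fixFrameStd fixFrameStd_conjTranspose fixFrameStd_trace n₁ n₂ n₃ hh' hc'
      (dirOf_fixCoord_seamBlockDir hQh hQ0)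
  have hker4 : frameHessRaw (L := L) fixFrameStd (ringCoord L p) *ᵥ fixCoord (conjDir (quatMatrix m) p) = 0 :=
    frameHessRaw_mulVec_fixCoord_conjDir_eq_zero (Summit.QuantumFields.BalabanUV.InfraRed.StrongCouplingSphereCalculus.quatMatrix_conjTranspose_of_re_eq_zero hm)
      (Summit.QuantumFields.BalabanUV.InfraRed.StrongCouplingSphereCalculus.quatMatrix_trace_of_re_eq_zero hm) hp0 htree
  have hker5 : frameHessRaw (L := L) fixFrameStd (ringCoord L p) *ᵥ fixCoord (conjDir (quatMatrix m') p) = 0 :=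
    frameHessRaw_mulVec_fixCoord_conjDir_eq_zero (Summit.QuantumFields.BalabanUV.InfraRed.StrongCouplingSphereCalculus.quatMatrix_conjTranspose_of_re_eq_zero hm')
      (Summit.QuantumFields.BalabanUV.InfraRed.StrongCouplingSphereCalculus.quatMatrix_trace_of_re_eq_zero hm') hp0 htree
  -- orthogonality (sheet–sheet: disjoint supports; conjugation–sheet: `⊥ n` against `∥ n`; conjugation–conjugation: `m ⊥ m'`)
  have h01 := fixCoord_wrap_dot_wrap_of_ne (L := L) (show (0 : Fin 3) ≠ 1 by decide) Q
  have h02 := fixCoord_wrap_dot_wrap_of_ne (L := L) (show (0 : Fin 3) ≠ 2 by decide) Q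
  have h12 := fixCoord_wrap_dot_wrap_of_ne (L := L) (show (1 : Fin 3) ≠ 2 by decide) Q
  have h03 := fixCoord_wrap_dot_seam (L := L) 0 Q
  have h13 := fixCoord_wrap_dot_seam (L := L) 1 Q
  have h23 := fixCoord_wrap_dot_seam (L := L) 2 Q
  have h40 := fixCoord_conj_dot_wrap (L := L) n₁ n₂ n₃ hh' hc' hm hmn 0
  have h41 := fixCoord_conj_dot_wrap (L := L) n₁ n₂ n₃ hh' hc' hm hmn 1
  have h42 := fixCoord_conj_dot_wrap (L := L) n₁ n₂ n₃ hh' hc' hm hmn 2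
  have h43 := fixCoord_conj_dot_seam (L := L) n₁ n₂ n₃ hh' hc' hm hmn
  have h50 := fixCoord_conj_dot_wrap (L := L) n₁ n₂ n₃ hh' hc' hm' hm'n 0
  have h51 := fixCoord_conj_dot_wrap (L := L) n₁ n₂ n₃ hh' hc' hm' hm'n 1
  have h52 := fixCoord_conj_dot_wrap (L := L) n₁ n₂ n₃ hh' hc' hm' hm'n 2
  have h53 := fixCoord_conj_dot_seam (L := L) n₁ n₂ n₃ hh' hc' hm' hm'n
  have h45 := fixCoord_conj_dot_conj (L := L) n₁ n₂ n₃ hh' hc' hm hm' hmn hm'n hmm'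
  -- positivity
  have hq0 := fixCoord_wrap_dot_self_pos (L := L) 0 hQh hQ0 hQne
  have hq1 := fixCoord_wrap_dot_self_pos (L := L) 1 hQh hQ0 hQne
  have hq2 := fixCoord_wrap_dot_self_pos (L := L) 2 hQh hQ0 hQne
  have hq3 := fixCoord_seam_dot_self_pos (L := L) hQh hQ0 hQne
  have hq4 : 0 < fixCoord (conjDir (quatMatrix m) p) ⬝ᵥ fixCoord (conjDir (quatMatrix m) p) := by
    rcases hreg with ⟨k, hk⟩ | htc
    · exact fixCoord_conj_dot_self_pos_of_wrap n₁ n₂ n₃ hn c' hh' hm hmn hm0 hk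
    · exact fixCoord_conj_dot_self_pos_of_seam n₁ n₂ n₃ hn h' hc' hm hmn hm0 htc
  have hq5 : 0 < fixCoord (conjDir (quatMatrix m') p) ⬝ᵥ fixCoord (conjDir (quatMatrix m') p) := by
    rcases hreg with ⟨k, hk⟩ | htc
    · exact fixCoord_conj_dot_self_pos_of_wrap n₁ n₂ n₃ hn c' hh' hm' hm'n hm'0 hk
    · exact fixCoord_conj_dot_self_pos_of_seam n₁ n₂ n₃ hn h' hc' hm' hm'n hm'0 htc
  -- normalise
  obtain ⟨k, hon, hk⟩ := exists_orthonormal_six _ _ _ _ _ _ h01 h02 h03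
    (by rw [dotProduct_comm]; exact h40) (by rw [dotProduct_comm]; exact h50) h12 h13
    (by rw [dotProduct_comm]; exact h41) (by rw [dotProduct_comm]; exact h51) h23
    (by rw [dotProduct_comm]; exact h42) (by rw [dotProduct_comm]; exact h52)
    (by rw [dotProduct_comm]; exact h43) (by rw [dotProduct_comm]; exact h53) h45
    hq0 hq1 hq2 hq3 hq4 hq5 (hkerW 0) (hkerW 1) (hkerW 2) hkerS hker4 hker5
  refine ⟨k, hon, hk, fun a => ?_⟩
  rw [frameHess_eq_frameHessRaw_of_zero fixFrameStd fixFrameStd_conjTranspose hp0]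
  exact hk a

end Summit.QuantumFields.YangMills.Theorems.VirialFluxGap.FixFrame

end
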